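import Mathlib
import Summits.Ventures.PercRepro2.K2nRoutes

/-!
# The point-split candidate (PS1) is FALSE: `PointSplitBHKOne` fails on `K_{2,21}`
(blind cell PercRepro2, night-3 g27, 2026-08-29; `proofs/NIGHT3-CERT.md` §35.10 / §36)

On `K_{2,n}` (`K2nRoutes`) with the principal functionals `F = 1[A ⊆ C_s]`, `G = 1[A' ⊆ C_s]`,
`A ⊔ A'` the leaves, uniform weight `1/2`, `X = Y = ∅` and the split point `v` = the second hub,
every expectation of `CovForm.PointSplit.mixedFormW` is a product over the routes
(`expect_FA_conn`, `expect_FA`, `expect_conn`), and at `n = 21`, `|A| = 10` the point-split form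
`M(1_{v ∈ C_s}, 1)` equals `−160587861139834359 / 2^82 ≈ −3.32 × 10⁻⁸ < 0`
(`not_pointSplitBHKOne_K2_21`): the candidate (PS1) of `PointSplitBHK.lean` (§32.3) is refuted in
the kernel; (PS) = `PointSplitBHK` is untouched (its form on this family is positive, §35.10).
Own work; standard axioms.
-/

namespace Summit.Ventures.PercRepro2

namespace K2n

/-! ## The principal functionals -/

open Classical in
/-- `F_B(S) = 1[leaf ℓ ∈ S for every ℓ ∈ B]`: the principal cluster functional of the leaves `B`. -/
noncomputable def FA {n : ℕ} (B : Finset (Fin n)) : Set (Fin (n + 2)) → ℚ :=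
  fun S => if ∀ ℓ ∈ B, leaf ℓ ∈ S then 1 else 0

/-- `F_B` is increasing. -/
lemma monotone_FA {n : ℕ} (B : Finset (Fin n)) : Monotone (FA B) := by
  intro S T hST
  unfold FA
  split_ifs with h1 h2 <;> norm_num
  exact h2 fun ℓ hℓ => hST (h1 ℓ hℓ)

/-- `F_B` is nonnegative. -/
lemma FA_nonneg {n : ℕ} (B : Finset (Fin n)) (S : Set (Fin (n + 2))) : 0 ≤ FA B S := by
  unfold FA
  split_ifs <;> norm_num

/-- `F_A · F_{Aᶜ} = F_{univ}`. -/
lemma FA_mul_FA_compl {n : ℕ} (A : Finset (Fin n)) (S : Set (Fin (n + 2))) :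
    FA A S * FA Aᶜ S = FA Finset.univ S := by
  unfold FA
  by_cases h : ∀ ℓ ∈ (Finset.univ : Finset (Fin n)), leaf ℓ ∈ S
  · rw [if_pos h, if_pos (fun ℓ _ => h ℓ (Finset.mem_univ ℓ)),
      if_pos (fun ℓ _ => h ℓ (Finset.mem_univ ℓ))]
    norm_num
  · rw [if_neg h]
    push Not at h
    obtain ⟨ℓ₀, -, hℓ₀⟩ := h
    by_cases hA : ℓ₀ ∈ A
    · rw [if_neg (show ¬ ∀ ℓ ∈ A, leaf ℓ ∈ S from fun hall => hℓ₀ (hall ℓ₀ hA)), zero_mul]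
    · rw [if_neg (show ¬ ∀ ℓ ∈ Aᶜ, leaf ℓ ∈ S from
        fun hall => hℓ₀ (hall ℓ₀ (Finset.mem_compl.2 hA))), mul_zero]

/-! ## The pointwise route forms of the integrands -/

/-- `F_B(C_s) · 1_{s ↔ v}` as route indicators. -/
lemma FA_mul_conn_eq {n : ℕ} (B : Finset (Fin n)) (ω : Config (Fin n × Bool)) :
    FA B (cluster (ends n) ω 0) * (if Conn (ends n) ω 0 1 then (1 : ℚ) else 0) =
      (if ∀ ℓ, (ℓ ∈ B → ne00 (routeEquiv n ω ℓ) = true) ∧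
          (ℓ ∉ B → tt (routeEquiv n ω ℓ) = true) then (1 : ℚ) else 0) -
      (if ∀ ℓ, (ℓ ∈ B → ne00nrr (routeEquiv n ω ℓ) = true) ∧
          (ℓ ∉ B → nrr (routeEquiv n ω ℓ) = true) then (1 : ℚ) else 0) := by
  by_cases hc : Conn (ends n) ω 0 1
  · rw [if_pos hc, mul_one]
    obtain ⟨ℓ₀, h1, h2⟩ := (conn_sv_iff ω).1 hc
    have hsecond : ¬ ∀ ℓ, (ℓ ∈ B → ne00nrr (routeEquiv n ω ℓ) = true) ∧
        (ℓ ∉ B → nrr (routeEquiv n ω ℓ) = true) := by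
      intro hall
      obtain ⟨hB, hnB⟩ := hall ℓ₀
      by_cases hmem : ℓ₀ ∈ B
      · exact (nrr_iff ω ℓ₀).1 (Bool.and_eq_true_iff.1 (show (ne00 (routeEquiv n ω ℓ₀) && nrr (routeEquiv n ω ℓ₀)) = true from hB hmem)).2 ⟨h1, h2⟩
      · exact (nrr_iff ω ℓ₀).1 (hnB hmem) ⟨h1, h2⟩
    rw [if_neg hsecond, sub_zero]
    unfold FA
    have h12 : (∀ ℓ ∈ B, leaf ℓ ∈ cluster (ends n) ω 0) →
        ∀ ℓ, (ℓ ∈ B → ne00 (routeEquiv n ω ℓ) = true) ∧ (ℓ ∉ B → tt (routeEquiv n ω ℓ) = true) := by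
      intro h ℓ
      refine ⟨fun hB => ?_, fun _ => rfl⟩
      rw [ne00_iff]
      rcases (leaf_mem_cluster_iff ω ℓ).1 (h ℓ hB) with hf | ⟨ht, -⟩
      · exact Or.inl hf
      · exact Or.inr ht
    have h21 : (∀ ℓ, (ℓ ∈ B → ne00 (routeEquiv n ω ℓ) = true) ∧
        (ℓ ∉ B → tt (routeEquiv n ω ℓ) = true)) → ∀ ℓ ∈ B, leaf ℓ ∈ cluster (ends n) ω 0 := by
      intro h ℓ hB
      rw [leaf_mem_cluster_iff]
      rcases (ne00_iff ω ℓ).1 ((h ℓ).1 hB) with hf | ht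
      · exact Or.inl hf
      · exact Or.inr ⟨ht, hc⟩
    split_ifs with hP hQ hQ
    · rfl
    · exact absurd (h12 hP) hQ
    · exact absurd (h21 hQ) hP
    · rfl
  · rw [if_neg hc, mul_zero]
    have hall : ∀ ℓ, nrr (routeEquiv n ω ℓ) = true := fun ℓ =>
      (nrr_iff ω ℓ).2 fun h => hc ((conn_sv_iff ω).2 ⟨ℓ, h⟩)
    have hiff : (∀ ℓ, (ℓ ∈ B → ne00 (routeEquiv n ω ℓ) = true) ∧
        (ℓ ∉ B → tt (routeEquiv n ω ℓ) = true)) ↔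
        ∀ ℓ, (ℓ ∈ B → ne00nrr (routeEquiv n ω ℓ) = true) ∧
          (ℓ ∉ B → nrr (routeEquiv n ω ℓ) = true) := by
      constructor
      · intro h ℓ
        exact ⟨fun hB => show (ne00 (routeEquiv n ω ℓ) && nrr (routeEquiv n ω ℓ)) = true from Bool.and_eq_true_iff.2 ⟨(h ℓ).1 hB, hall ℓ⟩, fun _ => hall ℓ⟩
      · intro h ℓ
        exact ⟨fun hB => (Bool.and_eq_true_iff.1 (show (ne00 (routeEquiv n ω ℓ) && nrr (routeEquiv n ω ℓ)) = true from (h ℓ).1 hB)).1, fun _ => rfl⟩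
    rw [if_congr hiff rfl rfl, sub_self]

/-- `F_B(C_s) · 1_{s ↮ v}` as a route indicator. -/
lemma FA_mul_notconn_eq {n : ℕ} (B : Finset (Fin n)) (ω : Config (Fin n × Bool)) :
    FA B (cluster (ends n) ω 0) * (1 - (if Conn (ends n) ω 0 1 then (1 : ℚ) else 0)) =
      (if ∀ ℓ, (ℓ ∈ B → eq10 (routeEquiv n ω ℓ) = true) ∧
          (ℓ ∉ B → nrr (routeEquiv n ω ℓ) = true) then (1 : ℚ) else 0) := by
  by_cases hc : Conn (ends n) ω 0 1
  · rw [if_pos hc, sub_self, mul_zero]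
    obtain ⟨ℓ₀, h1, h2⟩ := (conn_sv_iff ω).1 hc
    rw [if_neg]
    intro hall
    obtain ⟨hB, hnB⟩ := hall ℓ₀
    by_cases hmem : ℓ₀ ∈ B
    · have := ((eq10_iff ω ℓ₀).1 (hB hmem)).2
      rw [h2] at this
      exact absurd this (by decide)
    · exact (nrr_iff ω ℓ₀).1 (hnB hmem) ⟨h1, h2⟩
  · rw [if_neg hc, sub_zero, mul_one]
    have hall : ∀ ℓ, nrr (routeEquiv n ω ℓ) = true := fun ℓ =>
      (nrr_iff ω ℓ).2 fun h => hc ((conn_sv_iff ω).2 ⟨ℓ, h⟩)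
    unfold FA
    have h12 : (∀ ℓ ∈ B, leaf ℓ ∈ cluster (ends n) ω 0) →
        ∀ ℓ, (ℓ ∈ B → eq10 (routeEquiv n ω ℓ) = true) ∧ (ℓ ∉ B → nrr (routeEquiv n ω ℓ) = true) := by
      intro h ℓ
      refine ⟨fun hB => ?_, fun _ => hall ℓ⟩
      rw [eq10_iff]
      rcases (leaf_mem_cluster_iff ω ℓ).1 (h ℓ hB) with hf | ⟨-, hsv⟩
      · refine ⟨hf, ?_⟩
        have hn := (nrr_iff ω ℓ).1 (hall ℓ)
        rcases Bool.eq_false_or_eq_true (ω (ℓ, true)) with ht | ht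
        · exact absurd ⟨hf, ht⟩ hn
        · exact ht
      · exact absurd hsv hc
    have h21 : (∀ ℓ, (ℓ ∈ B → eq10 (routeEquiv n ω ℓ) = true) ∧
        (ℓ ∉ B → nrr (routeEquiv n ω ℓ) = true)) → ∀ ℓ ∈ B, leaf ℓ ∈ cluster (ends n) ω 0 := by
      intro h ℓ hB
      rw [leaf_mem_cluster_iff]
      exact Or.inl ((eq10_iff ω ℓ).1 ((h ℓ).1 hB)).1
    split_ifs with hP hQ hQ
    · rfl
    · exact absurd (h12 hP) hQ
    · exact absurd (h21 hQ) hP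
    · rfl

/-- `1_{s ↔ v}` as a route indicator. -/
lemma conn_indicator_eq {n : ℕ} (ω : Config (Fin n × Bool)) :
    (if Conn (ends n) ω 0 1 then (1 : ℚ) else 0) =
      1 - (if ∀ ℓ, ((ℓ ∈ (∅ : Finset (Fin n))) → tt (routeEquiv n ω ℓ) = true) ∧
          (ℓ ∉ (∅ : Finset (Fin n)) → nrr (routeEquiv n ω ℓ) = true) then (1 : ℚ) else 0) := by
  by_cases hc : Conn (ends n) ω 0 1
  · rw [if_pos hc, if_neg, sub_zero]
    intro hall
    obtain ⟨ℓ₀, h1, h2⟩ := (conn_sv_iff ω).1 hc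
    exact (nrr_iff ω ℓ₀).1 ((hall ℓ₀).2 (Finset.notMem_empty ℓ₀)) ⟨h1, h2⟩
  · rw [if_neg hc, if_pos, sub_self]
    intro ℓ
    exact ⟨fun h => absurd h (Finset.notMem_empty ℓ), fun _ =>
      (nrr_iff ω ℓ).2 fun h => hc ((conn_sv_iff ω).2 ⟨ℓ, h⟩)⟩

/-! ## The expectations in closed form -/

/-- Two of the four route states lie in `{10, 01}`. -/
lemma sum_ne00nrr :
    ∑ ρ : Bool × Bool, (if ne00nrr ρ = true then (1 : ℚ) else 0) = 2 := by
  simp only [Fintype.sum_prod_type, Fintype.sum_bool]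
  norm_num [ne00nrr, ne00, nrr]

/-- `E[F_B · 1_{s ↔ v}] = (3/4)^|B| − (1/2)^|B| (3/4)^{n − |B|}`. -/
theorem expect_FA_conn {n : ℕ} (B : Finset (Fin n)) :
    expect (half n) (fun ω => FA B (cluster (ends n) ω 0) *
        (if Conn (ends n) ω 0 1 then (1 : ℚ) else 0)) =
      (3 / 4 : ℚ) ^ B.card - (1 / 2 : ℚ) ^ B.card * (3 / 4 : ℚ) ^ (n - B.card) := by
  simp_rw [FA_mul_conn_eq]
  rw [expect_sub', expect_routes_split, expect_routes_split, sum_ne00, sum_tt,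
    sum_ne00nrr, sum_nrr]
  norm_num

/-- `E[F_B · 1_{s ↮ v}] = (1/4)^|B| (3/4)^{n − |B|}`. -/
theorem expect_FA_notconn {n : ℕ} (B : Finset (Fin n)) :
    expect (half n) (fun ω => FA B (cluster (ends n) ω 0) *
        (1 - (if Conn (ends n) ω 0 1 then (1 : ℚ) else 0))) =
      (1 / 4 : ℚ) ^ B.card * (3 / 4 : ℚ) ^ (n - B.card) := by
  simp_rw [FA_mul_notconn_eq]
  rw [expect_routes_split, sum_eq10, sum_nrr]
  norm_num

/-- `E[F_B] = (3/4)^|B| − (1/2)^|B| (3/4)^{n − |B|} + (1/4)^|B| (3/4)^{n − |B|}`. -/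
theorem expect_FA {n : ℕ} (B : Finset (Fin n)) :
    expect (half n) (fun ω => FA B (cluster (ends n) ω 0)) =
      (3 / 4 : ℚ) ^ B.card - (1 / 2 : ℚ) ^ B.card * (3 / 4 : ℚ) ^ (n - B.card) +
        (1 / 4 : ℚ) ^ B.card * (3 / 4 : ℚ) ^ (n - B.card) := by
  have h : (fun ω => FA B (cluster (ends n) ω 0)) =
      (fun ω => FA B (cluster (ends n) ω 0) * (if Conn (ends n) ω 0 1 then (1 : ℚ) else 0) +
        FA B (cluster (ends n) ω 0) * (1 - (if Conn (ends n) ω 0 1 then (1 : ℚ) else 0))) := by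
    funext ω
    ring
  rw [h, expect_add', expect_FA_conn, expect_FA_notconn]

/-- `P(s ↔ v) = 1 − (3/4)^n`. -/
theorem expect_conn {n : ℕ} :
    expect (half n) (fun ω => if Conn (ends n) ω 0 1 then (1 : ℚ) else 0) =
      1 - (3 / 4 : ℚ) ^ n := by
  simp_rw [conn_indicator_eq]
  rw [expect_sub', expect_const, expect_routes_split, sum_tt, sum_nrr, Finset.card_empty]
  norm_num

/-! ## The point-split form on `K_{2,21}` and the refutation of (PS1) -/

/-- The leaves `ℓ < a`. -/
def leftLeaves (n a : ℕ) : Finset (Fin n) := Finset.univ.filter (fun ℓ => ℓ.val < a)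

/-- The indicator of `{s ↔ v}` as an `if`. -/
lemma indicator_conn_apply {n : ℕ} (ω : Config (Fin n × Bool)) :
    (connEvent (ends n) 0 1).indicator (1 : Config (Fin n × Bool) → ℚ) ω =
      if Conn (ends n) ω 0 1 then 1 else 0 := by
  by_cases h : Conn (ends n) ω 0 1
  · rw [Set.indicator_of_mem (show ω ∈ connEvent (ends n) 0 1 from h), if_pos h, Pi.one_apply]
  · rw [Set.indicator_of_notMem (show ω ∉ connEvent (ends n) 0 1 from h), if_neg h]

/-- **(PS1) is false**: on `K_{2,21}` at uniform weight `1/2`, with `X = Y = ∅`, the split point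
`v` = the second hub and the principal functionals of a `10 + 11` split of the leaves, the
point-split form `M(1_{v ∈ C_s}, 1)` of `CovForm.PointSplit.PointSplitBHKOne` is negative
(`= −160587861139834359 / 2^82 ≈ −3.32 × 10⁻⁸`). -/
theorem not_pointSplitBHKOne_K2_21 :
    ¬ CovForm.PointSplit.PointSplitBHKOne (R := ℚ) (ends 21) 0 := by
  intro h
  have hv := h (half 21) (isProbVec_half 21) ∅ ∅ 1 (FA (leftLeaves 21 10))
    (FA (leftLeaves 21 10)ᶜ) (monotone_FA _) (monotone_FA _) (FA_nonneg _) (FA_nonneg _)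
  unfold CovForm.PointSplit.mixedFormW at hv
  simp only [Finset.inter_self, Finset.union_self, CovForm.PointSplit.wExpect_empty,
    indicator_conn_apply, FA_mul_FA_compl, mul_one, one_mul, expect_FA_conn, expect_FA,
    expect_conn, expect_const] at hv
  have hc : (leftLeaves 21 10).card = 10 := by decide
  have hc' : (leftLeaves 21 10)ᶜ.card = 11 := by decide
  rw [hc, hc', Finset.card_univ, Fintype.card_fin] at hv
  norm_num at hv

end K2n

end Summit.Ventures.PercRepro2
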